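import Literature.NumberTheory.LFunctions.Zhang2022.RepairGapLemma102StepsPremise
import Literature.NumberTheory.LFunctions.Zhang2022.RepairGapLemma102WindowsPremise
import HarnessLib

/-!
# Zhang (2022), rescue GAP/BED (D-0124 (3)(4)): the LEMMA 10.2 LEAF of `theorem1_of_leaves` (reading of record RT-01′,
# `Skeleton.Lemma102RelW`) under the minimum premise `‖L(1,χ)‖ ≤ 𝓛⁻¹⁵` — UNCONDITIONAL

Topic `Literature/NumberTheory/LFunctions/Zhang2022` (Landau–Siegel audit tree; verdict-neutral).
Y. Zhang, *Discrete mean estimates and the Landau–Siegel zero*, arXiv:2211.02515v1 (2022)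
[Zhang2022LandauSiegel] — **an unrefereed manuscript under adjudication; nothing in this file asserts or
denies its Theorems 1–2, and nothing here is a claim about Landau–Siegel zeros. The programme SEARCHES and
TYPES; no claim about Landau–Siegel zeros, Theorems 1–2 of arXiv:2211.02515 or a repaired Margin232 until a
kernel theorem says so.**

The leaf `h102 : Skeleton.Lemma102RelW c′` of the whole-DAG theorem (`SkeletonWholeDAGv43`: `lemma102RelW_of_lemma83Rel h83`)
is assembled in the tree by `Skeleton.lemma102RelW_of_logMean0Rel` from LEMMA A (`Typed.Sec10Rel.LogMean0Rel`) and the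
window clause (`Eq1011RelD`) through sz-d43's `Section10Lemma102Steps` and the packaging `lemma102RelW_iff_eqs` — all typed
under the standing guard `AssumptionA D χ`, which is only THREADED into LEMMA A. Every analytic input is now kernel under
`‖L(1,χ)‖ ≤ 𝓛⁻¹⁵` and UNCONDITIONAL: `Lemma102.logMean0Rel_pow15` (`RepairGapLemma102LogMeanPremise`), the three clauses
`Lemma102.eq108Rel_pow15_of_logMean` / `eq109Rel_pow15_of_logMean` / `eq1010Rel_pow15_of_logMean`
(`RepairGapLemma102StepsPremise`), the window clause `Lemma102.eq1011RelD_pow15` (`RepairGapLemma102WindowsPremise`). This file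
runs the `.mpr` half of `Skeleton.lemma102RelW_iff_eqs` VERBATIM on them:

* `Skeleton.lemma102RelW_pow15` — **the body of the leaf `Skeleton.Lemma102RelW c′` (§10 Lemma 10.2 (10.8)–(10.11), pp. 55–56;
  rows G-d43-1 / G-d60-1) with its guard `AssumptionA D χ` replaced by `‖L(1,χ)‖ ≤ 𝓛⁻¹⁵`, UNCONDITIONAL**, every `c′`,
  one uniform constant `max (max C₂ C₃) (max C₄ C₅)` exactly as in the tree;
* `Skeleton.lemma102RelW_of_assumptionAWith` — under `Repair.Bed.AssumptionAWith E` for every real `E ≥ 15` (at the printed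
  `E = 2022` the body is that of the tree theorem `Skeleton.lemma102RelW_of_lemma83Rel Skeleton.lemma83Rel_holds`, not
  restated).

TALLY (as-typed; rescue GAP row G-31, BED §0.2): the Part-II leaves of node group 2 — 8.2 (`Skeleton.lemma82_pow15`), 8.3
(`Skeleton.lemma83Rel_pow15`), 8.4 (`Skeleton.lemma84Rel_pow15`), 10.1 (`Lemma101.lemma101_pow15`), 10.2 (this file) — are
kernel at (A)-exponent 15. Theorems only (packaging); no definition, no named fact; nothing about (A) itself. Private
bookkeeping helpers copied unchanged from `SkeletonLemma102RelW`.

## References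

* Y. Zhang, arXiv:2211.02515v1 (2022), §10 Lemma 10.2 (10.8)–(10.11), pp. 55–56. [cite: Zhang2022LandauSiegel, §10 Lemma 10.2]
-/

noncomputable section

open Complex Real Finset

namespace Literature.NumberTheory.LFunctions.Zhang2022.Skeleton

open Literature.NumberTheory.LFunctions.Zhang2022
open Literature.NumberTheory.LFunctions.Zhang2022.Repair.Bed (AssumptionAWith)

/-! ## Bookkeeping helpers (copied from `SkeletonLemma102RelW`) -/

/-- `(𝓛ᵏ)⁻¹ ≥ 0`. [folklore] -/
private theorem ell_pow_inv_nonneg' (D k : ℕ) : 0 ≤ (ell D ^ k)⁻¹ :=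
  inv_nonneg.mpr (pow_nonneg (Real.log_natCast_nonneg D) k)

/-- `R(d,r) = (∏_{q∣dr}(1 − q⁻¹)⁻¹)² ≥ 1`. [folklore] -/
private theorem one_le_relFactor' (n : ℕ) :
    1 ≤ (∏ q ∈ n.primeFactors, (1 - (q : ℝ)⁻¹)⁻¹) ^ 2 := by
  have hprod : 1 ≤ ∏ q ∈ n.primeFactors, (1 - (q : ℝ)⁻¹)⁻¹ := by
    refine le_of_eq_of_le (Finset.prod_const_one (s := n.primeFactors)).symm
      (Finset.prod_le_prod (fun _ _ => zero_le_one) fun q hq => ?_)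
    have hq2 : (2 : ℝ) ≤ q := by exact_mod_cast (Nat.prime_of_mem_primeFactors hq).two_le
    have h1 : 0 < 1 - (q : ℝ)⁻¹ := by
      have : (q : ℝ)⁻¹ ≤ 1 / 2 := by rw [inv_eq_one_div]; gcongr
      linarith
    have h2 : 1 - (q : ℝ)⁻¹ ≤ 1 := by
      have : 0 ≤ (q : ℝ)⁻¹ := by positivity
      linarith
    exact (one_le_inv₀ h1).mpr h2
  nlinarith

/-- `R(d,r) ≥ 0`. [folklore] -/
private theorem relFactor_nonneg' (n : ℕ) :
    0 ≤ (∏ q ∈ n.primeFactors, (1 - (q : ℝ)⁻¹)⁻¹) ^ 2 :=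
  zero_le_one.trans (one_le_relFactor' n)

/-- The window scale is `≥ 0`. [folklore] -/
private theorem windowScale_nonneg (D : ℕ) :
    0 ≤ ell D * (1 + Real.log (bigT D)) ^ 4 / Real.log (bigP D) := by
  have hℓ : 0 ≤ ell D := Real.log_natCast_nonneg D
  have hlogP : Real.log (bigP D) = ell D ^ 9 := by rw [bigP, Real.log_exp]
  have hlogT : 0 ≤ 1 + Real.log (bigT D) := by
    rw [bigT, Real.log_exp]; positivity
  rw [hlogP]
  positivity

/-- Enlarging the constant in a bound `t ≤ C·a·R` (`a, R ≥ 0`). [folklore] -/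
private theorem lift_const' {C C' a R t : ℝ} (ht : t ≤ C * a * R) (hC : C ≤ C') (ha : 0 ≤ a)
    (hR : 0 ≤ R) : t ≤ C' * a * R :=
  ht.trans (mul_le_mul_of_nonneg_right (mul_le_mul_of_nonneg_right hC ha) hR)

/-! ## The leaf -/

/-- **LEMMA 10.2 (reading of record RT-01′) UNDER THE MINIMUM PREMISE, UNCONDITIONAL** — the body of the leaf
`Skeleton.Lemma102RelW c′` (§10 pp. 55–56: (10.8)–(10.10) in relative form with error `C𝓛⁻¹⁵(∏_{q∣dr}(1−q⁻¹)⁻¹)²`, and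
(10.11) in the tail-mean form on the three edge windows, ONE uniform `C`) with its guard `AssumptionA D χ` replaced by
`‖L(1,χ)‖ ≤ 𝓛⁻¹⁵`; every `c′`. The `.mpr` half of `Skeleton.lemma102RelW_iff_eqs` verbatim over
`Lemma102.eq108Rel_pow15_of_logMean` / `eq109Rel_pow15_of_logMean` / `eq1010Rel_pow15_of_logMean` (fed with
`Lemma102.logMean0Rel_pow15`) and `Lemma102.eq1011RelD_pow15`. [cite: Zhang2022LandauSiegel, §10 Lemma 10.2 pp.55–56] -/
theorem lemma102RelW_pow15 (c' : ℝ) :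
    ∃ C : ℝ, ForAllLarge fun D _ χ => ‖χ.LFunction 1‖ ≤ 1 / Real.log D ^ 15 →
      ∀ j ∈ ({1, 2, 3} : Finset ℕ), ∀ d r : ℕ, 1 ≤ d → 1 ≤ r →
        (((d * r : ℕ) : ℝ) ≤ bigP D ^ (0.5 : ℝ) / bigT D →
          ‖frakv2 c' χ j d r - deriv χ.LFunction 1 * PiW χ d r / 500 *
            (betaJ c' D (j + 1) * betaJ c' D (j + 2)) * Real.log (bigP D)‖ ≤
              C * (ell D ^ 15)⁻¹ * (∏ q ∈ (d * r).primeFactors, (1 - (q : ℝ)⁻¹)⁻¹) ^ 2) ∧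
        (bigP D ^ (0.5 : ℝ) < ((d * r : ℕ) : ℝ) → ((d * r : ℕ) : ℝ) ≤ bigP D ^ (0.502 : ℝ) / bigT D →
          ‖frakv2 c' χ j d r - 500 * deriv χ.LFunction 1 * PiW χ d r / Real.log (bigP D) *
            (-1 + fraky1 c' D j ((d * r : ℕ) : ℝ))‖ ≤
              C * (ell D ^ 15)⁻¹ * (∏ q ∈ (d * r).primeFactors, (1 - (q : ℝ)⁻¹)⁻¹) ^ 2) ∧
        (bigP D ^ (0.502 : ℝ) < ((d * r : ℕ) : ℝ) →
          ((d * r : ℕ) : ℝ) ≤ bigP D ^ (0.504 : ℝ) / bigT D →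
          ‖frakv2 c' χ j d r - 500 * deriv χ.LFunction 1 * PiW χ d r / Real.log (bigP D) *
            (1 + fraky2 c' D j ((d * r : ℕ) : ℝ))‖ ≤
              C * (ell D ^ 15)⁻¹ * (∏ q ∈ (d * r).primeFactors, (1 - (q : ℝ)⁻¹)⁻¹) ^ 2) ∧
        ((bigP D ^ (0.5 : ℝ) / bigT D < ((d * r : ℕ) : ℝ) ∧ ((d * r : ℕ) : ℝ) ≤ bigP D ^ (0.5 : ℝ)) ∨
            (bigP D ^ (0.502 : ℝ) / bigT D < ((d * r : ℕ) : ℝ) ∧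
              ((d * r : ℕ) : ℝ) ≤ bigP D ^ (0.502 : ℝ)) ∨
            (bigP D ^ (0.504 : ℝ) / bigT D < ((d * r : ℕ) : ℝ) ∧
              ((d * r : ℕ) : ℝ) < bigP D ^ (0.504 : ℝ)) →
          ‖frakv2 c' χ j d r‖ ≤
            C * ell D * (1 + Real.log (bigT D)) ^ 4 / Real.log (bigP D) *
              (∏ q ∈ (d * r).primeFactors, (1 - (q : ℝ)⁻¹)⁻¹) ^ 2) := by
  obtain ⟨C₂, h₂⟩ := Lemma102.eq108Rel_pow15_of_logMean (Lemma102.logMean0Rel_pow15 c')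
  obtain ⟨C₃, h₃⟩ := Lemma102.eq109Rel_pow15_of_logMean (Lemma102.logMean0Rel_pow15 c')
  obtain ⟨C₄, h₄⟩ := Lemma102.eq1010Rel_pow15_of_logMean (Lemma102.logMean0Rel_pow15 c')
  obtain ⟨C₅, h₅⟩ := Lemma102.eq1011RelD_pow15 c'
  refine ⟨max (max C₂ C₃) (max C₄ C₅), ((h₂.and h₃).and (h₄.and h₅)).mono ?_⟩
  intro D _ χ _ _ h hA j hj d r hd hr
  obtain ⟨⟨k₂, k₃⟩, k₄, k₅⟩ := h
  have h15 := ell_pow_inv_nonneg' D 15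
  have hW := windowScale_nonneg D
  have hR := relFactor_nonneg' (d * r)
  refine ⟨fun hy => lift_const' (k₂ hA j hj d r hd hr hy)
      ((le_max_left _ _).trans (le_max_left _ _)) h15 hR,
    fun hy1 hy2 => lift_const' (k₃ hA j hj d r hd hr hy1 hy2)
      ((le_max_right _ _).trans (le_max_left _ _)) h15 hR,
    fun hy1 hy2 => lift_const' (k₄ hA j hj d r hd hr hy1 hy2)
      ((le_max_left _ _).trans (le_max_right _ _)) h15 hR,
    fun hy => ?_⟩
  have := k₅ hA j hj d r hd hr ((Typed.Sec10A.mem_edgeWindows_iff D _).mpr hy)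
  rw [mul_div_assoc, mul_assoc C₅] at this
  rw [mul_div_assoc, mul_assoc (max (max C₂ C₃) (max C₄ C₅))]
  exact lift_const' (a := ell D * ((1 + Real.log (bigT D)) ^ 4 / Real.log (bigP D))) this
    ((le_max_right _ _).trans (le_max_right _ _)) (by rw [← mul_div_assoc]; exact hW) hR

/-- **Lemma 10.2 (RT-01′) under `Repair.Bed.AssumptionAWith E`, every real `E ≥ 15`, UNCONDITIONAL** (transfer
`Repair.Gap.forAllLarge_assumptionAWith_of_pow15` at `lemma102RelW_pow15`; at the printed `E = 2022` the body is that of the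
tree leaf `Skeleton.Lemma102RelW c′`, a tree theorem via `lemma102RelW_of_lemma83Rel lemma83Rel_holds`, not restated).
[cite: Zhang2022LandauSiegel, §10 Lemma 10.2 pp.55–56] -/
theorem lemma102RelW_of_assumptionAWith (c' : ℝ) {E : ℝ} (hE : 15 ≤ E) :
    ∃ C : ℝ, ForAllLarge fun D _ χ => AssumptionAWith E D χ →
      ∀ j ∈ ({1, 2, 3} : Finset ℕ), ∀ d r : ℕ, 1 ≤ d → 1 ≤ r →
        (((d * r : ℕ) : ℝ) ≤ bigP D ^ (0.5 : ℝ) / bigT D →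
          ‖frakv2 c' χ j d r - deriv χ.LFunction 1 * PiW χ d r / 500 *
            (betaJ c' D (j + 1) * betaJ c' D (j + 2)) * Real.log (bigP D)‖ ≤
              C * (ell D ^ 15)⁻¹ * (∏ q ∈ (d * r).primeFactors, (1 - (q : ℝ)⁻¹)⁻¹) ^ 2) ∧
        (bigP D ^ (0.5 : ℝ) < ((d * r : ℕ) : ℝ) → ((d * r : ℕ) : ℝ) ≤ bigP D ^ (0.502 : ℝ) / bigT D →
          ‖frakv2 c' χ j d r - 500 * deriv χ.LFunction 1 * PiW χ d r / Real.log (bigP D) *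
            (-1 + fraky1 c' D j ((d * r : ℕ) : ℝ))‖ ≤
              C * (ell D ^ 15)⁻¹ * (∏ q ∈ (d * r).primeFactors, (1 - (q : ℝ)⁻¹)⁻¹) ^ 2) ∧
        (bigP D ^ (0.502 : ℝ) < ((d * r : ℕ) : ℝ) →
          ((d * r : ℕ) : ℝ) ≤ bigP D ^ (0.504 : ℝ) / bigT D →
          ‖frakv2 c' χ j d r - 500 * deriv χ.LFunction 1 * PiW χ d r / Real.log (bigP D) *
            (1 + fraky2 c' D j ((d * r : ℕ) : ℝ))‖ ≤
              C * (ell D ^ 15)⁻¹ * (∏ q ∈ (d * r).primeFactors, (1 - (q : ℝ)⁻¹)⁻¹) ^ 2) ∧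
        ((bigP D ^ (0.5 : ℝ) / bigT D < ((d * r : ℕ) : ℝ) ∧ ((d * r : ℕ) : ℝ) ≤ bigP D ^ (0.5 : ℝ)) ∨
            (bigP D ^ (0.502 : ℝ) / bigT D < ((d * r : ℕ) : ℝ) ∧
              ((d * r : ℕ) : ℝ) ≤ bigP D ^ (0.502 : ℝ)) ∨
            (bigP D ^ (0.504 : ℝ) / bigT D < ((d * r : ℕ) : ℝ) ∧
              ((d * r : ℕ) : ℝ) < bigP D ^ (0.504 : ℝ)) →
          ‖frakv2 c' χ j d r‖ ≤
            C * ell D * (1 + Real.log (bigT D)) ^ 4 / Real.log (bigP D) *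
              (∏ q ∈ (d * r).primeFactors, (1 - (q : ℝ)⁻¹)⁻¹) ^ 2) := by
  obtain ⟨C, h⟩ := lemma102RelW_pow15 c'
  exact ⟨C, Repair.Gap.forAllLarge_assumptionAWith_of_pow15 hE h⟩

end Literature.NumberTheory.LFunctions.Zhang2022.Skeleton

end
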